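import Mathlib.RingTheory.Localization.Integer
import Mathlib.RingTheory.Noetherian.Basic
import Mathlib.RingTheory.DedekindDomain.Ideal.Lemmas
import Mathlib.NumberTheory.NumberField.Completion.FinitePlace
import Mathlib.Topology.Algebra.Valued.LocallyCompact
import Literature.NumberTheory.Automorphic.QuaternionicFormsProofs
import Literature.NumberTheory.Automorphic.QuaternionAlgebraAdelicInputs
import Literature.NumberTheory.Automorphic.GLnAdelicStructureProofs
import Literature.NumberTheory.Automorphic.JordanZassenhaus
import HarnessLib

/-!
# The class number of `Dˣ`: Borel's Thm. 5.1 for `G = Dˣ` from the Jordan–Zassenhaus theorem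

Third proof file of `Literature.NumberTheory.Automorphic.QuaternionicForms` (after
`QuaternionicFormsProofs` and `JordanZassenhaus`), discharging the named facts
`QuaternionicForm.exists_isCompact_isOpen_finite_doubleQuotient` (Borel, *Some finiteness
properties of adele groups over number fields*, Publ. IHÉS 16 (1963), §1.2 and Thm. 5.1 for the
algebraic group `G = Dˣ`, `D` a quaternion algebra over a number field `K`: there is a compact
open subgroup `U₀ ≤ D_fˣ = (𝔸_K^∞ ⊗_K D)ˣ` with `Dˣ \ D_fˣ / U₀` finite) and
`QuaternionicForm.finite_doubleQuotient` (`Dˣ \ D_fˣ / U` finite for every open `U`):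
`QuaternionicForm.exists_isCompact_isOpen_finite_doubleQuotient_holds`,
`QuaternionicForm.finite_doubleQuotient_holds`.

Borel's printed proof (reduction theory: Siegel domains and fundamental sets, §§4–5) is not
followed. Instead we take the classical route through lattices (Vignéras, LNM 800, Ch. III §5,
"dictionnaire global-adélique" and Thm. 5.4; Weil, *Basic Number Theory*, Ch. V §2), which for
`G = Dˣ` gives the same statement:

1. `U₀` is the stabiliser in `D_fˣ` of the *standard adelic lattice* `L̂ = ⊕_i 𝒪̂_K (1 ⊗ e_i)`
   (`e` a `K`-basis of `D`, `𝒪̂_K = ∏_v 𝒪_v` the integral finite adeles); it is open, and compact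
   because `𝒪̂_K` is (Tychonoff; each `𝒪_v` is compact — complete, a DVR, with finite residue
   field — `AdicCompletionCompact`);
2. `x ↦ D ∩ x L̂` sends `D_fˣ` to full lattices in `D` which are right modules over the right
   order `Λ = O_r(L)` of `L = ⊕ 𝓞_K e_i`; it is right `U₀`-invariant, left `Dˣ`-equivariant, and
   injective on `D_fˣ / U₀` because `D` is dense in `D_f` (strong approximation for the additive
   group, proved here for any Dedekind domain), so that an open subgroup of `D_f` is the closure
   of its rational points;
3. by the Jordan–Zassenhaus theorem (proved in `JordanZassenhaus`,
   `hasFiniteClassSet_of_isQuaternionAlgebra`) the full right `Λ`-lattices in `D` fall into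
   finitely many `Dˣ`-orbits; hence `Dˣ \ D_fˣ / U₀` is finite.

What is *proved* here (sorry-free), on top of sibling files: for the integral finite adeles
`integralFiniteAdeles K = 𝒪̂_K` of `GLnAdelicStructure` (open there, compact by
`GLnAdelicStructureProofs.isCompact_integralFiniteAdeles`, the `𝒪_v` being compact,
`AdicCompletionCompact`), the facts `K ∩ 𝒪̂_K = 𝓞_K` and common denominators
(`algebraMap_mem_integralFiniteAdeles_iff`, `exists_mul_mem_integralFiniteAdeles`, from the
place-wise statements of `AdeleRingTopology`); **strong approximation for the additive group**,
i.e. the density of `K` in `𝔸_K^∞` for any Dedekind domain (`denseRange_algebraMap_finiteAdeleRing`,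
from the density of `R` in each `𝒪_v` proved in `AdeleRingTopology` and the Chinese remainder
theorem, `exists_forall_valued_algebraMap_sub_lt`); the standard adelic lattice
`adelicLattice K D`, its multiplier monoid `multiplier K D` and stabiliser `unitStabilizer K D`
(compact open); the global lattices `latticeOf K D x`,
`globalLattice K D`, the right order `rightOrder K D`, their fullness
(`isFullLattice_latticeOf`, `isFullLattice_rightOrder`), invariance, equivariance and
injectivity (`inv_mul_mem_unitStabilizer_of_latticeOf_eq`); the density of `D` in `D_f`
(`denseRange_incl`); the Jordan–Zassenhaus theorem in the form needed (`jordanZassenhaus`, from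
`hasFiniteClassSet_of_isQuaternionAlgebra` of the sibling file `JordanZassenhaus`); and the
assembly `finite_doubleQuotient_unitStabilizer`,
`QuaternionicForm.exists_isCompact_isOpen_finite_doubleQuotient_holds`,
`QuaternionicForm.finite_doubleQuotient_holds`. Nothing is vendored: the file and its imports
are sorry-free and hypothesis-free.

## References

* A. Borel, *Some finiteness properties of adele groups over number fields*, Publ. Math. IHÉS 16
  (1963), §1.2, Thm. 5.1.
* A. Weil, *Basic Number Theory* (1967), Ch. IV §2 Thm. 3 Cor. 2; Ch. V §2 Def. 3, Prop. 4, Thm. 2.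
* M.-F. Vignéras, *Arithmétique des algèbres de quaternions*, LNM 800 (1980), Ch. III §1 Thm. 1.4,
  §5 Thm. 5.4 and "dictionnaire global-adélique".
* R. G. Swan (notes by E. G. Evans), *K-theory of finite groups and orders*, LNM 149 (1970), Ch. 3,
  Thm. 3.9, Cor. 3.10, Lemma 3.11.
* I. Reiner, *Maximal Orders* (1975/2003), §26, Thm. (26.4).
-/

noncomputable section

open scoped TensorProduct Pointwise RestrictedProduct
open NumberField IsDedekindDomain MulAction Topology

universe u

namespace Literature.NumberTheory.Automorphic

/-! ### The integral finite adeles `𝒪̂_K = ∏_v 𝒪_v ⊆ 𝔸_K^∞`: rational points and denominators -/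

section IntegralAdeles

variable (K : Type) [Field K] [NumberField K]

/-- `𝓞_K ⊆ 𝒪̂_K` (for the subring `integralFiniteAdeles K` of `GLnAdelicStructure`). [folklore] -/
theorem algebraMap_integers_mem_integralFiniteAdeles (r : 𝓞 K) :
    algebraMap (𝓞 K) (FiniteAdeleRing (𝓞 K) K) r ∈ integralFiniteAdeles K := fun v =>
  HeightOneSpectrum.coe_algebraMap_mem (𝓞 K) K v r

variable {K} in
/-- An element of `K` lies in `𝒪̂_K` iff it lies in `𝓞_K` (`K ∩ ∏_v 𝒪_v = 𝓞_K`,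
`AdeleRingTopology.exists_algebraMap_eq_of_forall_coe_mem`). [folklore] -/
theorem algebraMap_mem_integralFiniteAdeles_iff {k : K} :
    algebraMap K (FiniteAdeleRing (𝓞 K) K) k ∈ integralFiniteAdeles K ↔
      k ∈ (algebraMap (𝓞 K) K).range := by
  constructor
  · intro h
    obtain ⟨r, hr⟩ := exists_algebraMap_eq_of_forall_coe_mem (𝓞 K) K k fun v => by
      rw [← FiniteAdeleRing.algebraMap_apply (R := 𝓞 K)]
      exact h v
    exact ⟨r, hr⟩
  · rintro ⟨r, rfl⟩
    rw [← IsScalarTower.algebraMap_apply]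
    exact algebraMap_integers_mem_integralFiniteAdeles K r

/-- **Denominators of finite adeles**: every finite family of finite adeles has a common
denominator in `𝓞_K ∖ {0}` (one adele at a time this is
`AdeleRingTopology.FiniteAdeleRing.exists_ne_zero_forall_mul_mem`; take the product). [folklore] -/
theorem exists_mul_mem_integralFiniteAdeles {ι : Type*} [Finite ι]
    (a : ι → FiniteAdeleRing (𝓞 K) K) :
    ∃ c : 𝓞 K, c ≠ 0 ∧ ∀ i, algebraMap (𝓞 K) (FiniteAdeleRing (𝓞 K) K) c * a i ∈
      integralFiniteAdeles K := by
  classical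
  haveI := Fintype.ofFinite ι
  choose c hc hc' using fun i => FiniteAdeleRing.exists_ne_zero_forall_mul_mem (𝓞 K) K (a i)
  refine ⟨∏ i, c i, Finset.prod_ne_zero_iff.mpr fun i _ => hc i, fun i => ?_⟩
  rw [← Finset.prod_erase_mul _ _ (Finset.mem_univ i), map_mul, mul_assoc]
  exact mul_mem (algebraMap_integers_mem_integralFiniteAdeles K _) (hc' i)

end IntegralAdeles

/-! ### Strong approximation for the additive group: `K` is dense in `𝔸_K^∞` -/

section StrongApproximation

open WithZeroTopology
open scoped WithZero

variable (R : Type*) [CommRing R] [IsDedekindDomain R] (K : Type*) [Field K] [Algebra R K]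
  [IsFractionRing R K]

/-- **Simultaneous approximation** (`R` is dense in each `𝒪_v`,
`AdeleRingTopology.exists_valued_algebraMap_sub_lt`, and the Chinese remainder theorem, Mathlib
`IsDedekindDomain.exists_forall_sub_mem_ideal`): finitely many `v`-adic integers are
simultaneously approximated, to any prescribed precisions, by one global integer (Weil, BNT
Ch. V §2 Cor. 1 of Thm. 1: `𝔯` is dense in `∏ r_v`). [folklore] -/
theorem exists_forall_valued_algebraMap_sub_lt (s : Finset (HeightOneSpectrum R))
    (u : ∀ v : HeightOneSpectrum R, v.adicCompletion K) (hu : ∀ v ∈ s, Valued.v (u v) ≤ 1)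
    (δ : HeightOneSpectrum R → ℤᵐ⁰) (hδ : ∀ v ∈ s, δ v ≠ 0) :
    ∃ y : R, ∀ v ∈ s, Valued.v (algebraMap R (v.adicCompletion K) y - u v) < δ v := by
  classical
  have loc : ∀ v ∈ s, ∃ r : R, Valued.v (algebraMap R (v.adicCompletion K) r - u v) < δ v := by
    intro v hv
    obtain ⟨z, hz⟩ := HeightOneSpectrum.valuedAdicCompletion_surjective K v (δ v)
    have hz0 : z ≠ 0 := fun h => hδ v hv (by rw [← hz, h, map_zero])
    simpa only [hz] using exists_valued_algebraMap_sub_lt R K v (hu v hv) hz0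
  choose! r hr using loc
  have hN : ∀ v ∈ s, ∃ N : ℕ, WithZero.exp (-(N : ℤ)) < δ v :=
    fun v hv => WithZero.exists_exp_neg_natCast_lt (hδ v hv)
  choose! N hN using hN
  obtain ⟨y, hy⟩ := IsDedekindDomain.exists_forall_sub_mem_ideal
    (fun v : HeightOneSpectrum R => v.asIdeal) N (fun v _ => v.prime)
    (fun v _ w _ hvw h => hvw (HeightOneSpectrum.ext h)) (fun v : s => r v)
  refine ⟨y, fun v hv => ?_⟩
  have e1 : Valued.v (algebraMap R (v.adicCompletion K) y -
      algebraMap R (v.adicCompletion K) (r v)) < δ v := by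
    rw [← map_sub, IsScalarTower.algebraMap_apply R K (v.adicCompletion K),
      show algebraMap K (v.adicCompletion K) (algebraMap R K (y - r v)) =
        ((algebraMap R K (y - r v) : K) : v.adicCompletion K) from rfl,
      HeightOneSpectrum.valuedAdicCompletion_eq_valuation', HeightOneSpectrum.valuation_of_algebraMap]
    exact lt_of_le_of_lt ((v.intValuation_le_pow_iff_mem _ _).mpr (hy v hv)) (hN v hv)
  have := Valuation.map_add_lt Valued.v e1 (hr v hv)
  rwa [sub_add_sub_cancel] at this

/-- **Strong approximation for the additive group: `K` is dense in `𝔸_K^∞`.** For a Dedekind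
domain `R` with fraction field `K`, the diagonal image of `K` is dense in the ring of finite
adeles `𝔸_K^∞ = ∏'_v K_v`. Proof: given `a ∈ 𝔸_K^∞` and an open `V ∋ a`, clear denominators
(`c a ∈ 𝒪̂`, `c ∈ R ∖ 0`, `AdeleRingTopology.FiniteAdeleRing.exists_ne_zero_forall_mul_mem`), read off from the restricted-product topology finitely many places and
valuation balls inside `c V`, approximate simultaneously by `y ∈ R`
(`exists_forall_valued_algebraMap_sub_lt`), and take `y / c ∈ K`. For number fields this is
Weil, BNT Ch. IV §2, Cor. 2 of Thm. 3 ("`E + E_v` is dense in `E_A`", with `E = k` and `v`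
archimedean, projected onto the finite adeles); Vignéras III §1 Thm. 1.4 (Adèles 2). Mathlib
(pinned revision) has the density of `K` in each `K_v` (`HeightOneSpectrum.denseRange_algebraMap`)
but not this simultaneous statement. [cite: WeilBNT1967, Ch. IV §2 Thm. 3 Cor. 2] -/
theorem denseRange_algebraMap_finiteAdeleRing :
    DenseRange (algebraMap K (FiniteAdeleRing R K)) := by
  classical
  refine dense_iff_inter_open.mpr fun V hV ⟨a, haV⟩ => ?_
  obtain ⟨c, hc0, hc⟩ := FiniteAdeleRing.exists_ne_zero_forall_mul_mem R K a
  have hcK : (algebraMap R K c) ≠ 0 :=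
    fun h => hc0 (IsFractionRing.injective R K (by rw [h, map_zero]))
  set C : FiniteAdeleRing R K := algebraMap R (FiniteAdeleRing R K) c with hC
  set Cinv : FiniteAdeleRing R K := algebraMap K (FiniteAdeleRing R K) (algebraMap R K c)⁻¹
    with hCinv
  have hCC : Cinv * C = 1 := by
    rw [hC, hCinv, IsScalarTower.algebraMap_apply R K (FiniteAdeleRing R K), ← map_mul,
      inv_mul_cancel₀ hcK, map_one]
  set b : FiniteAdeleRing R K := C * a with hb
  -- the open neighbourhood `V' = C · V` of `b ∈ 𝒪̂`
  set V' : Set (FiniteAdeleRing R K) := (fun w => Cinv * w) ⁻¹' V with hV'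
  have hV'o : IsOpen V' := hV.preimage (continuous_const_mul Cinv)
  have hbV' : b ∈ V' := by
    change Cinv * (C * a) ∈ V
    rwa [← mul_assoc, hCC, one_mul]
  -- `b` comes from the structure map of the restricted product
  set b' : ∀ v : HeightOneSpectrum R, ↥((v.adicCompletionIntegers K : Set (v.adicCompletion K))) :=
    fun v => ⟨b v, hc v⟩ with hb'
  have hbb : (show FiniteAdeleRing R K from
      RestrictedProduct.structureMap (HeightOneSpectrum.adicCompletion (R := R) K)
        (fun v : HeightOneSpectrum R => (v.adicCompletionIntegers K : Set (v.adicCompletion K)))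
        Filter.cofinite b') = b :=
    FiniteAdeleRing.ext K fun v => rfl
  have hAopen : ∀ v : HeightOneSpectrum R,
      IsOpen (v.adicCompletionIntegers K : Set (v.adicCompletion K)) :=
    fun v => Valued.isOpen_valuationSubring _
  have hV'n : V' ∈ 𝓝 b := hV'o.mem_nhds hbV'
  rw [← hbb] at hV'n
  have hV'n' : V' ∈ @nhds (Πʳ v : HeightOneSpectrum R, [v.adicCompletion K, v.adicCompletionIntegers K])
      _ (RestrictedProduct.structureMap (HeightOneSpectrum.adicCompletion (R := R) K)
      (fun v : HeightOneSpectrum R => (v.adicCompletionIntegers K : Set (v.adicCompletion K)))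
      Filter.cofinite b') := hV'n
  rw [RestrictedProduct.nhds_eq_map_structureMap hAopen] at hV'n'
  have h3 := Filter.mem_map.mp hV'n'
  rw [nhds_pi] at h3
  obtain ⟨I, t, ht, hIt⟩ := Filter.mem_pi'.mp h3
  -- valuation balls inside the `t v`
  have hball : ∀ v : HeightOneSpectrum R, ∃ δ : ℤᵐ⁰, δ ≠ 0 ∧
      ∀ w : ↥((v.adicCompletionIntegers K : Set (v.adicCompletion K))),
        Valued.v ((w : v.adicCompletion K) - b v) < δ → w ∈ t v := by
    intro v
    obtain ⟨o, ho, hot⟩ := (mem_nhds_subtype _ _ _).mp (ht v)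
    obtain ⟨γ, hγ⟩ := Valued.mem_nhds.mp ho
    refine ⟨MonoidWithZeroHom.ValueGroup₀.embedding γ.1, ?_, fun w hw => hot (hγ ?_)⟩
    · intro h0
      apply γ.ne_zero
      have : MonoidWithZeroHom.ValueGroup₀.embedding γ.1 =
          MonoidWithZeroHom.ValueGroup₀.embedding (0 : MonoidWithZeroHom.ValueGroup₀
            (.ofClass (Valued.v (R := v.adicCompletion K)))) := by rw [h0, map_zero]
      exact MonoidWithZeroHom.ValueGroup₀.embedding_strictMono.injective this
    · change Valued.v.restrict ((w : v.adicCompletion K) - b v) < γ.1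
      rw [Valuation.restrict_lt_iff_lt_embedding]
      exact hw
  choose δ hδ0 hδ using hball
  obtain ⟨y, hy⟩ := exists_forall_valued_algebraMap_sub_lt R K I (fun v => b v)
    (fun v _ => (v.mem_adicCompletionIntegers R K).mp (hc v)) δ (fun v _ => hδ0 v)
  -- the global element `y / c` does it
  set z : ∀ v : HeightOneSpectrum R, ↥((v.adicCompletionIntegers K : Set (v.adicCompletion K))) :=
    fun v => ⟨algebraMap R (v.adicCompletion K) y, v.coe_algebraMap_mem R K y⟩ with hz
  have hzt : z ∈ Set.pi (↑I) t := fun v hv => hδ v _ (hy v (Finset.mem_coe.mp hv))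
  have hzV := hIt hzt
  change Cinv * (show FiniteAdeleRing R K from
      RestrictedProduct.structureMap (HeightOneSpectrum.adicCompletion (R := R) K)
        (fun v : HeightOneSpectrum R => (v.adicCompletionIntegers K : Set (v.adicCompletion K)))
        Filter.cofinite z) ∈ V at hzV
  refine ⟨_, hzV, (algebraMap R K c)⁻¹ * algebraMap R K y, ?_⟩
  rw [map_mul, ← hCinv]
  congr 1

end StrongApproximation

/-! ### The standard adelic lattice `L̂ ⊆ D_f` and its stabiliser `U₀ ⊆ D_fˣ` -/

section AdelicLattice

variable (K : Type) [Field K] [NumberField K] (D : Type u) [Ring D] [Algebra K D]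
  [Module.Finite K D]

/-- The `𝔸_K^∞`-basis `ẽ_i = 1 ⊗ e_i` of `D_f = 𝔸_K^∞ ⊗_K D` obtained from the `K`-basis
`e = Module.finBasis K D` of `D` (Mathlib `Algebra.TensorProduct.basis`). [folklore] -/
def adelicBasis :
    Module.Basis (Fin (Module.finrank K D)) (FiniteAdeleRing (𝓞 K) K)
      (ScalarExtension K (FiniteAdeleRing (𝓞 K) K) D) :=
  Algebra.TensorProduct.basis (FiniteAdeleRing (𝓞 K) K) (Module.finBasis K D)

/-- `ẽ_i = 1 ⊗ e_i = incl (e_i)`. [folklore] -/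
theorem adelicBasis_apply (i : Fin (Module.finrank K D)) :
    adelicBasis K D i =
      ScalarExtension.incl K (FiniteAdeleRing (𝓞 K) K) D (Module.finBasis K D i) :=
  Algebra.TensorProduct.basis_apply _ _

/-- The coordinates of `incl d = 1 ⊗ d` in the basis `ẽ` are the coordinates of `d` in `e`. [folklore] -/
theorem adelicBasis_repr_incl (d : D) (i : Fin (Module.finrank K D)) :
    (adelicBasis K D).repr (ScalarExtension.incl K (FiniteAdeleRing (𝓞 K) K) D d) i =
      algebraMap K (FiniteAdeleRing (𝓞 K) K) ((Module.finBasis K D).repr d i) := by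
  change (Algebra.TensorProduct.basis (FiniteAdeleRing (𝓞 K) K) (Module.finBasis K D)).repr
    ((1 : FiniteAdeleRing (𝓞 K) K) ⊗ₜ[K] d) i = _
  rw [Algebra.TensorProduct.basis_repr_tmul, one_smul, Finsupp.mapRange_apply]

/-- The sibling file's coordinate map is the coordinate map of `adelicBasis` (definitional). [folklore] -/
theorem coordLinearEquiv_apply (x : ScalarExtension K (FiniteAdeleRing (𝓞 K) K) D)
    (i : Fin (Module.finrank K D)) :
    ScalarExtension.coordLinearEquiv K (FiniteAdeleRing (𝓞 K) K) D x i = (adelicBasis K D).repr x i :=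
  rfl

/-- The **standard adelic lattice** `L̂ = ⊕_i 𝒪̂_K ẽ_i ⊆ D_f`: elements of `D_f = 𝔸_K^∞ ⊗_K D`
whose coordinates in the basis `1 ⊗ e_i` are integral finite adeles; for almost all `v` its
`v`-component `⊕ 𝒪_v e_i` is a maximal order of `D_v` (Vignéras III §1, proof of Lemme 1.1 bis:
"le réseau engendré par `(e)` sur `R_v`"), and `L̂ = ∏_v L_v` is the adelic lattice attached to
the global lattice `L = ⊕ 𝓞_K e_i` (Weil, BNT Ch. V §2). [folklore] -/
def adelicLattice : AddSubgroup (ScalarExtension K (FiniteAdeleRing (𝓞 K) K) D) where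
  carrier := {x | ∀ i, (adelicBasis K D).repr x i ∈ integralFiniteAdeles K}
  add_mem' {x y} hx hy i := by
    rw [map_add, Finsupp.add_apply]
    exact add_mem (hx i) (hy i)
  zero_mem' i := by
    rw [map_zero, Finsupp.zero_apply]
    exact zero_mem _
  neg_mem' {x} hx i := by
    rw [map_neg, Finsupp.neg_apply]
    exact neg_mem (hx i)

/-- Membership in `L̂`: all coordinates are integral (definitional). [folklore] -/
theorem mem_adelicLattice_iff {x : ScalarExtension K (FiniteAdeleRing (𝓞 K) K) D} :
    x ∈ adelicLattice K D ↔ ∀ i, (adelicBasis K D).repr x i ∈ integralFiniteAdeles K := Iff.rfl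

/-- `L̂` is an `𝒪̂_K`-module. [folklore] -/
theorem smul_mem_adelicLattice {a : FiniteAdeleRing (𝓞 K) K} (ha : a ∈ integralFiniteAdeles K)
    {x : ScalarExtension K (FiniteAdeleRing (𝓞 K) K) D} (hx : x ∈ adelicLattice K D) :
    a • x ∈ adelicLattice K D := fun i => by
  rw [map_smul, Finsupp.smul_apply, smul_eq_mul]
  exact mul_mem ha (hx i)

/-- The basis vectors `ẽ_i` lie in `L̂`. [folklore] -/
theorem adelicBasis_mem (i : Fin (Module.finrank K D)) : adelicBasis K D i ∈ adelicLattice K D := by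
  intro j
  rw [Module.Basis.repr_self, Finsupp.single_apply]
  split_ifs
  · exact one_mem _
  · exact zero_mem _

/-- `incl d ∈ L̂` iff all coordinates of `d ∈ D` in the basis `e` lie in `𝓞_K`
(`K ∩ 𝒪̂_K = 𝓞_K`). [folklore] -/
theorem incl_mem_adelicLattice_iff {d : D} :
    ScalarExtension.incl K (FiniteAdeleRing (𝓞 K) K) D d ∈ adelicLattice K D ↔
      ∀ i, (Module.finBasis K D).repr d i ∈ (algebraMap (𝓞 K) K).range := by
  simp only [mem_adelicLattice_iff, adelicBasis_repr_incl, algebraMap_mem_integralFiniteAdeles_iff]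

/-- **Denominators in `D_f`**: every element of `D_f` is moved into `L̂` by a nonzero scalar
from `𝓞_K`. [folklore] -/
theorem exists_smul_mem_adelicLattice (x : ScalarExtension K (FiniteAdeleRing (𝓞 K) K) D) :
    ∃ c : 𝓞 K, c ≠ 0 ∧
      algebraMap (𝓞 K) (FiniteAdeleRing (𝓞 K) K) c • x ∈ adelicLattice K D := by
  obtain ⟨c, hc, h⟩ := exists_mul_mem_integralFiniteAdeles K fun i => (adelicBasis K D).repr x i
  refine ⟨c, hc, fun i => ?_⟩
  rw [map_smul, Finsupp.smul_apply, smul_eq_mul]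
  exact h i

/-- `L̂` is open in `D_f` (it corresponds to the open box `𝒪̂_K^n` under the coordinate
homeomorphism `D_f ≃ₜ (𝔸_K^∞)^n`). [folklore] -/
theorem isOpen_adelicLattice :
    IsOpen (adelicLattice K D : Set (ScalarExtension K (FiniteAdeleRing (𝓞 K) K) D)) := by
  have : (adelicLattice K D : Set (ScalarExtension K (FiniteAdeleRing (𝓞 K) K) D)) =
      ScalarExtension.coordHomeomorph K (FiniteAdeleRing (𝓞 K) K) D ⁻¹'
        Set.pi Set.univ fun _ => (integralFiniteAdeles K : Set (FiniteAdeleRing (𝓞 K) K)) := by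
    ext x
    simp only [SetLike.mem_coe, mem_adelicLattice_iff, Set.mem_preimage, Set.mem_pi,
      Set.mem_univ, true_implies, ScalarExtension.coordHomeomorph_apply, coordLinearEquiv_apply]
  rw [this]
  exact (isOpen_set_pi Set.finite_univ fun _ _ => isOpen_integralFiniteAdeles K).preimage
    (ScalarExtension.coordHomeomorph K (FiniteAdeleRing (𝓞 K) K) D).continuous

/-- `L̂` is closed in `D_f` (an open subgroup is closed). [folklore] -/
theorem isClosed_adelicLattice :
    IsClosed (adelicLattice K D : Set (ScalarExtension K (FiniteAdeleRing (𝓞 K) K) D)) :=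
  AddSubgroup.isClosed_of_isOpen _ (isOpen_adelicLattice K D)

/-- `L̂` is compact (`L̂ ≃ₜ 𝒪̂_K^n`, the `𝒪_v` are compact, Tychonoff). [folklore] -/
theorem isCompact_adelicLattice :
    IsCompact (adelicLattice K D : Set (ScalarExtension K (FiniteAdeleRing (𝓞 K) K) D)) := by
  have : (adelicLattice K D : Set (ScalarExtension K (FiniteAdeleRing (𝓞 K) K) D)) =
      ScalarExtension.coordHomeomorph K (FiniteAdeleRing (𝓞 K) K) D ⁻¹'
        Set.pi Set.univ fun _ => (integralFiniteAdeles K : Set (FiniteAdeleRing (𝓞 K) K)) := by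
    ext x
    simp only [SetLike.mem_coe, mem_adelicLattice_iff, Set.mem_preimage, Set.mem_pi,
      Set.mem_univ, true_implies, ScalarExtension.coordHomeomorph_apply, coordLinearEquiv_apply]
  rw [this]
  exact (ScalarExtension.coordHomeomorph K (FiniteAdeleRing (𝓞 K) K) D).isCompact_preimage.mpr
    (isCompact_univ_pi fun _ => isCompact_integralFiniteAdeles K)

/-- The **multiplier monoid** `A = {x ∈ D_f : x L̂ ⊆ L̂}` of the standard adelic lattice (the
adelic left order `∏_v O_l(L_v)` intersected with nothing: a compact open submonoid of `D_f`). [folklore] -/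
def multiplier : Submonoid (ScalarExtension K (FiniteAdeleRing (𝓞 K) K) D) where
  carrier := {x | ∀ y ∈ adelicLattice K D, x * y ∈ adelicLattice K D}
  one_mem' y hy := by rwa [one_mul]
  mul_mem' {a b} ha hb y hy := by
    rw [mul_assoc]
    exact ha _ (hb _ hy)

/-- `x ∈ A ↔ x L̂ ⊆ L̂` (definitional). [folklore] -/
theorem mem_multiplier_iff' {x : ScalarExtension K (FiniteAdeleRing (𝓞 K) K) D} :
    x ∈ multiplier K D ↔ ∀ y ∈ adelicLattice K D, x * y ∈ adelicLattice K D := Iff.rfl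

/-- `x L̂ ⊆ L̂` iff `x ẽ_i ∈ L̂` for every basis vector (`L̂ = ⊕ 𝒪̂_K ẽ_i`). [folklore] -/
theorem mem_multiplier_iff {x : ScalarExtension K (FiniteAdeleRing (𝓞 K) K) D} :
    x ∈ multiplier K D ↔ ∀ i, x * adelicBasis K D i ∈ adelicLattice K D := by
  refine ⟨fun h i => h _ (adelicBasis_mem K D i), fun h y hy => ?_⟩
  rw [← (adelicBasis K D).sum_repr y, Finset.mul_sum]
  refine sum_mem fun i _ => ?_
  rw [mul_smul_comm]
  exact smul_mem_adelicLattice K D (hy i) (h i)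

/-- `A` is open in `D_f`. [folklore] -/
theorem isOpen_multiplier :
    IsOpen (multiplier K D : Set (ScalarExtension K (FiniteAdeleRing (𝓞 K) K) D)) := by
  have : (multiplier K D : Set (ScalarExtension K (FiniteAdeleRing (𝓞 K) K) D)) =
      ⋂ i, (fun x => x * adelicBasis K D i) ⁻¹'
        (adelicLattice K D : Set (ScalarExtension K (FiniteAdeleRing (𝓞 K) K) D)) := by
    ext x
    simp only [SetLike.mem_coe, mem_multiplier_iff, Set.mem_iInter, Set.mem_preimage]
  rw [this]
  exact isOpen_iInter_of_finite fun i =>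
    (isOpen_adelicLattice K D).preimage (continuous_mul_const _)

/-- `A` is closed in `D_f`. [folklore] -/
theorem isClosed_multiplier :
    IsClosed (multiplier K D : Set (ScalarExtension K (FiniteAdeleRing (𝓞 K) K) D)) := by
  have : (multiplier K D : Set (ScalarExtension K (FiniteAdeleRing (𝓞 K) K) D)) =
      ⋂ i, (fun x => x * adelicBasis K D i) ⁻¹'
        (adelicLattice K D : Set (ScalarExtension K (FiniteAdeleRing (𝓞 K) K) D)) := by
    ext x
    simp only [SetLike.mem_coe, mem_multiplier_iff, Set.mem_iInter, Set.mem_preimage]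
  rw [this]
  exact isClosed_iInter fun i => (isClosed_adelicLattice K D).preimage (continuous_mul_const _)

/-- `A` is compact: if `c ∈ 𝓞_K ∖ 0` clears the denominators of `1 ∈ D_f`, then
`A = A · 1 ⊆ c⁻¹ L̂`. [folklore] -/
theorem isCompact_multiplier :
    IsCompact (multiplier K D : Set (ScalarExtension K (FiniteAdeleRing (𝓞 K) K) D)) := by
  obtain ⟨c, hc, h1⟩ := exists_smul_mem_adelicLattice K D 1
  have ha : IsUnit (algebraMap (𝓞 K) (FiniteAdeleRing (𝓞 K) K) c) := by
    rw [IsScalarTower.algebraMap_apply (𝓞 K) K (FiniteAdeleRing (𝓞 K) K)]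
    exact ((RingOfIntegers.coe_ne_zero_iff).mpr hc).isUnit.map _
  refine ((isCompact_adelicLattice K D).image
    (continuous_const_smul ((ha.unit⁻¹ : (FiniteAdeleRing (𝓞 K) K)ˣ) :
      FiniteAdeleRing (𝓞 K) K))).of_isClosed_subset (isClosed_multiplier K D) fun x hx => ?_
  refine ⟨algebraMap (𝓞 K) (FiniteAdeleRing (𝓞 K) K) c • x, ?_, ?_⟩
  · have := hx _ h1
    rwa [mul_smul_comm, mul_one] at this
  · change ((ha.unit⁻¹ : (FiniteAdeleRing (𝓞 K) K)ˣ) : FiniteAdeleRing (𝓞 K) K) •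
      algebraMap (𝓞 K) (FiniteAdeleRing (𝓞 K) K) c • x = x
    rw [smul_smul, IsUnit.val_inv_mul, one_smul]

/-- The **stabiliser** `U₀ = {u ∈ D_fˣ : u L̂ = L̂}` of the standard adelic lattice, i.e. the
units of the multiplier monoid: Borel's `∏_𝔭 G_{𝔬_𝔭}` for `G = Dˣ` up to commensurability
(Borel 1963 §1.2; Vignéras III §5 "dictionnaire global-adélique"). [folklore] -/
def unitStabilizer : Subgroup (finiteAdelicUnits K D) := (multiplier K D).units

/-- `u ∈ U₀ ↔ u L̂ ⊆ L̂ ∧ u⁻¹ L̂ ⊆ L̂` (definitional). [folklore] -/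
theorem mem_unitStabilizer_iff {u : finiteAdelicUnits K D} :
    u ∈ unitStabilizer K D ↔
      (u : ScalarExtension K (FiniteAdeleRing (𝓞 K) K) D) ∈ multiplier K D ∧
        ((u⁻¹ : finiteAdelicUnits K D) : ScalarExtension K (FiniteAdeleRing (𝓞 K) K) D) ∈
          multiplier K D :=
  Submonoid.mem_units_iff _ _

/-- `U₀` is open in `D_fˣ`. [folklore] -/
theorem isOpen_unitStabilizer : IsOpen (unitStabilizer K D : Set (finiteAdelicUnits K D)) := by
  have : (unitStabilizer K D : Set (finiteAdelicUnits K D)) =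
      Units.val ⁻¹' (multiplier K D : Set (ScalarExtension K (FiniteAdeleRing (𝓞 K) K) D)) ∩
        (fun u : finiteAdelicUnits K D =>
          ((u⁻¹ : finiteAdelicUnits K D) : ScalarExtension K (FiniteAdeleRing (𝓞 K) K) D)) ⁻¹'
          (multiplier K D : Set (ScalarExtension K (FiniteAdeleRing (𝓞 K) K) D)) := by
    ext u
    exact mem_unitStabilizer_iff K D
  rw [this]
  exact ((isOpen_multiplier K D).preimage Units.continuous_val).inter
    ((isOpen_multiplier K D).preimage Units.continuous_coe_inv)

/-- `U₀` is compact (units of a compact monoid in a Hausdorff topological ring, Mathlib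
`Submonoid.units_isCompact`): Borel 1963 §1.2, "`G_{𝔬_𝔭}` is a compact open subgroup". [folklore] -/
theorem isCompact_unitStabilizer :
    IsCompact (unitStabilizer K D : Set (finiteAdelicUnits K D)) := by
  haveI : T2Space (FiniteAdeleRing (𝓞 K) K) := t2Space_finiteAdeleRing K
  exact Submonoid.units_isCompact (isCompact_multiplier K D)

end AdelicLattice

/-! ### Global lattices: the lattice `D ∩ x L̂` of an adelic point -/

section GlobalLattices

variable (K : Type) [Field K] [NumberField K] (D : Type u) [Ring D] [Algebra K D]

variable {D} in
/-- From an `𝓞_K`-denominator to a `ℤ`-denominator, for `𝓞_K`-stable submodules. [folklore] -/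
theorem exists_zsmul_mem_of_smul_mem {M : Submodule ℤ D}
    (hM : ∀ (r : 𝓞 K) {m : D}, m ∈ M → (r : K) • m ∈ M) {d : D} {c : 𝓞 K} (hc : c ≠ 0)
    (hd : (c : K) • d ∈ M) : ∃ n : ℤ, n ≠ 0 ∧ n • d ∈ M := by
  obtain ⟨n, hn, t, ht⟩ := exists_natCast_eq_mul hc
  refine ⟨n, Int.natCast_ne_zero.mpr hn, ?_⟩
  have := hM t hd
  rwa [smul_smul, RingOfIntegers.coe_eq_algebraMap, RingOfIntegers.coe_eq_algebraMap,
    ← map_mul, ht, map_natCast, Nat.cast_smul_eq_nsmul, ← natCast_zsmul] at this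

/-- `incl : D → D_f` is `K`-linear: `incl (k • d) = k • incl d = (k)_𝔸 • incl d`. [folklore] -/
theorem incl_smul (k : K) (d : D) :
    ScalarExtension.incl K (FiniteAdeleRing (𝓞 K) K) D (k • d) =
      algebraMap K (FiniteAdeleRing (𝓞 K) K) k •
        ScalarExtension.incl K (FiniteAdeleRing (𝓞 K) K) D d := by
  rw [map_smul, algebraMap_smul]

variable [Module.Finite K D]

/-- The **global lattice of an adelic point**: for `x ∈ D_fˣ`,
`latticeOf x = D ∩ x L̂ = {d ∈ D : x⁻¹ (1 ⊗ d) ∈ L̂}`, a `ℤ`-submodule of `D` (Weil, BNT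
Ch. V §2 Thm. 2: `M = ⋂_v (E ∩ M_v)`; Vignéras III §5 "dictionnaire global-adélique": the ideal
attached to `(x_v) ∈ H_A^×`). [folklore] -/
def latticeOf (x : finiteAdelicUnits K D) : Submodule ℤ D :=
  (((adelicLattice K D).comap
    ((AddMonoidHom.mulLeft ((x⁻¹ : finiteAdelicUnits K D) :
        ScalarExtension K (FiniteAdeleRing (𝓞 K) K) D)).comp
      (ScalarExtension.incl K (FiniteAdeleRing (𝓞 K) K) D).toRingHom.toAddMonoidHom))).toIntSubmodule

variable {D} in
/-- `d ∈ latticeOf x ↔ x⁻¹ · incl d ∈ L̂` (definitional). [folklore] -/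
theorem mem_latticeOf_iff {x : finiteAdelicUnits K D} {d : D} :
    d ∈ latticeOf K D x ↔
      ((x⁻¹ : finiteAdelicUnits K D) : ScalarExtension K (FiniteAdeleRing (𝓞 K) K) D) *
        ScalarExtension.incl K (FiniteAdeleRing (𝓞 K) K) D d ∈ adelicLattice K D :=
  Iff.rfl

/-- The **standard global lattice** `L = D ∩ L̂ = latticeOf 1 = ⊕_i 𝓞_K e_i`. [folklore] -/
def globalLattice : Submodule ℤ D := latticeOf K D 1

variable {D} in
/-- `d ∈ L ↔ incl d ∈ L̂`. [folklore] -/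
theorem mem_globalLattice_iff {d : D} :
    d ∈ globalLattice K D ↔
      ScalarExtension.incl K (FiniteAdeleRing (𝓞 K) K) D d ∈ adelicLattice K D := by
  rw [globalLattice, mem_latticeOf_iff, inv_one, Units.val_one, one_mul]

variable {D} in
/-- `d ∈ L ↔` all coordinates of `d` in the basis `e` lie in `𝓞_K`, i.e. `L = ⊕ 𝓞_K e_i`. [folklore] -/
theorem mem_globalLattice_iff_repr {d : D} :
    d ∈ globalLattice K D ↔ ∀ i, (Module.finBasis K D).repr d i ∈ (algebraMap (𝓞 K) K).range := by
  rw [mem_globalLattice_iff, incl_mem_adelicLattice_iff]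

variable {D} in
/-- `L` is an `𝓞_K`-module. [folklore] -/
theorem smul_mem_globalLattice (r : 𝓞 K) {d : D} (hd : d ∈ globalLattice K D) :
    (r : K) • d ∈ globalLattice K D := by
  rw [mem_globalLattice_iff, incl_smul, ← IsScalarTower.algebraMap_apply]
  exact smul_mem_adelicLattice K D (algebraMap_integers_mem_integralFiniteAdeles K r)
    ((mem_globalLattice_iff K).mp hd)

/-- The basis vectors `e_i` lie in `L`. [folklore] -/
theorem finBasis_mem_globalLattice (i : Fin (Module.finrank K D)) :
    Module.finBasis K D i ∈ globalLattice K D := by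
  rw [mem_globalLattice_iff, ← adelicBasis_apply]
  exact adelicBasis_mem K D i

/-- **Common denominators in `D`**: a finite family of elements of `D` is moved into `L` by one
nonzero scalar from `𝓞_K`. [folklore] -/
theorem exists_smul_mem_globalLattice {ι : Type*} [Finite ι] (f : ι → D) :
    ∃ c : 𝓞 K, c ≠ 0 ∧ ∀ i, (c : K) • f i ∈ globalLattice K D := by
  obtain ⟨c, hc, h⟩ := exists_mul_mem_integralFiniteAdeles K fun p : ι × Fin (Module.finrank K D) =>
    (adelicBasis K D).repr (ScalarExtension.incl K (FiniteAdeleRing (𝓞 K) K) D (f p.1)) p.2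
  refine ⟨c, hc, fun i => ?_⟩
  rw [mem_globalLattice_iff, incl_smul, ← IsScalarTower.algebraMap_apply]
  intro j
  rw [map_smul, Finsupp.smul_apply, smul_eq_mul]
  exact h (i, j)

/-- `L` is finitely generated: it is the image of `𝓞_K^n` under `r ↦ ∑ r_i e_i`. [folklore] -/
theorem globalLattice_fg : (globalLattice K D).FG := by
  classical
  let c : (Fin (Module.finrank K D) → 𝓞 K) →ₗ[ℤ] (Fin (Module.finrank K D) → K) :=
    (AddMonoidHom.pi fun i => ((algebraMap (𝓞 K) K).toAddMonoidHom.comp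
      (Pi.evalAddMonoidHom (fun _ => 𝓞 K) i))).toIntLinearMap
  let s : (Fin (Module.finrank K D) → K) →ₗ[ℤ] D :=
    (Module.finBasis K D).equivFun.symm.toLinearMap.toAddMonoidHom.toIntLinearMap
  refine Submodule.FG.of_le (Submodule.FG.map (s ∘ₗ c) Module.Finite.fg_top) fun d hd => ?_
  rw [Submodule.map_top, LinearMap.mem_range]
  choose r hr using (mem_globalLattice_iff_repr K).mp hd
  refine ⟨r, ?_⟩
  change (Module.finBasis K D).equivFun.symm (fun i => algebraMap (𝓞 K) K (r i)) = d
  conv_rhs => rw [← (Module.finBasis K D).equivFun.symm_apply_apply d]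
  congr 1
  funext i
  rw [hr i, Module.Basis.equivFun_apply]

/-- `L` is a full lattice. [folklore] -/
theorem isFullLattice_globalLattice : IsFullLattice D (globalLattice K D) := by
  refine ⟨globalLattice_fg K D, fun d => ?_⟩
  obtain ⟨c, hc, h⟩ := exists_smul_mem_globalLattice K D fun _ : Unit => d
  exact exists_zsmul_mem_of_smul_mem K (fun r _ hm => smul_mem_globalLattice K r hm) hc (h ())

variable {D} in
/-- Every element of `L` is an `𝓞_K`-combination of the basis: `l = ∑ r_i e_i`, `r_i ∈ 𝓞_K`. [folklore] -/
theorem exists_eq_sum_of_mem_globalLattice {l : D} (hl : l ∈ globalLattice K D) :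
    ∃ r : Fin (Module.finrank K D) → 𝓞 K, l = ∑ i, (r i : K) • Module.finBasis K D i := by
  choose r hr using (mem_globalLattice_iff_repr K).mp hl
  refine ⟨r, ?_⟩
  conv_lhs => rw [← (Module.finBasis K D).sum_repr l]
  refine Finset.sum_congr rfl fun i _ => ?_
  rw [RingOfIntegers.coe_eq_algebraMap, hr i]

/-! #### The right order `Λ = O_r(L)` -/

/-- The **right order** `Λ = O_r(L) = {a ∈ D : L a ⊆ L}` of the standard lattice, as a
`ℤ`-submodule of `D`; it contains `1`, is closed under multiplication (`one_mem_rightOrder`,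
`mul_mem_rightOrder`) and is a full lattice (`isFullLattice_rightOrder`), i.e. it is a
`ℤ`-order (indeed an `𝓞_K`-order) of `D` (Reiner, *Maximal Orders*, §8; Vignéras I §4). [folklore] -/
def rightOrder : Submodule ℤ D where
  carrier := {a | ∀ l ∈ globalLattice K D, l * a ∈ globalLattice K D}
  add_mem' {a b} ha hb l hl := by
    rw [mul_add]
    exact add_mem (ha l hl) (hb l hl)
  zero_mem' l hl := by
    rw [mul_zero]
    exact zero_mem _
  smul_mem' n {a} ha l hl := by
    rw [mul_smul_comm]
    exact Submodule.smul_mem _ n (ha l hl)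

variable {D} in
/-- `a ∈ Λ ↔ L a ⊆ L` (definitional). [folklore] -/
theorem mem_rightOrder_iff {a : D} :
    a ∈ rightOrder K D ↔ ∀ l ∈ globalLattice K D, l * a ∈ globalLattice K D := Iff.rfl

/-- `1 ∈ Λ`. [folklore] -/
theorem one_mem_rightOrder : (1 : D) ∈ rightOrder K D := fun l hl => by rwa [mul_one]

variable {D} in
/-- `Λ` is closed under multiplication. [folklore] -/
theorem mul_mem_rightOrder {a b : D} (ha : a ∈ rightOrder K D) (hb : b ∈ rightOrder K D) :
    a * b ∈ rightOrder K D := fun l hl => by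
  rw [← mul_assoc]
  exact hb _ (ha l hl)

variable {D} in
/-- `Λ` is an `𝓞_K`-module (`K` is central in `D` and `L` is an `𝓞_K`-module). [folklore] -/
theorem smul_mem_rightOrder (r : 𝓞 K) {a : D} (ha : a ∈ rightOrder K D) :
    (r : K) • a ∈ rightOrder K D := fun l hl => by
  rw [mul_smul_comm]
  exact smul_mem_globalLattice K r (ha l hl)

variable {D} in
/-- `a ∈ Λ` as soon as `e_i a ∈ L` for all basis vectors (`L = ⊕ 𝓞_K e_i` is an `𝓞_K`-module). [folklore] -/
theorem mem_rightOrder_of_forall {a : D} (ha : ∀ i, Module.finBasis K D i * a ∈ globalLattice K D) :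
    a ∈ rightOrder K D := fun l hl => by
  obtain ⟨r, rfl⟩ := exists_eq_sum_of_mem_globalLattice K hl
  rw [Finset.sum_mul]
  refine sum_mem fun i _ => ?_
  rw [smul_mul_assoc]
  exact smul_mem_globalLattice K (r i) (ha i)

/-- `Λ` is a full lattice: `Λ ⊆ c⁻¹ L` where `c ∈ 𝓞_K ∖ 0` clears the denominators of `1`,
and every `a ∈ D` has `c a ∈ Λ` for a common denominator `c` of the `e_i a`. [folklore] -/
theorem isFullLattice_rightOrder : IsFullLattice D (rightOrder K D) := by
  constructor
  · obtain ⟨c, hc, h1⟩ := exists_smul_mem_globalLattice K D fun _ : Unit => (1 : D)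
    have hcK : (c : K) ≠ 0 := RingOfIntegers.coe_ne_zero_iff.mpr hc
    refine Submodule.FG.of_le
      ((globalLattice_fg K D).map (DistribSMul.toLinearMap ℤ D (c : K)⁻¹)) fun a ha => ?_
    refine ⟨(c : K) • a, ?_, ?_⟩
    · have := ha _ (h1 ())
      rwa [smul_mul_assoc, one_mul] at this
    · change (c : K)⁻¹ • (c : K) • a = a
      rw [smul_smul, inv_mul_cancel₀ hcK, one_smul]
  · intro a
    obtain ⟨c, hc, h⟩ := exists_smul_mem_globalLattice K D fun i => Module.finBasis K D i * a
    refine exists_zsmul_mem_of_smul_mem K (fun r _ hm => smul_mem_rightOrder K r hm) hc ?_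
    refine mem_rightOrder_of_forall K fun i => ?_
    rw [mul_smul_comm]
    exact h i

/-! #### Properties of `latticeOf` -/

variable {D}

/-- `L̂` is stable under right multiplication by `incl Λ` (`ẽ_i · a = incl (e_i a) ∈ L̂`). [folklore] -/
theorem mul_incl_mem_adelicLattice {z : ScalarExtension K (FiniteAdeleRing (𝓞 K) K) D}
    (hz : z ∈ adelicLattice K D) {a : D} (ha : a ∈ rightOrder K D) :
    z * ScalarExtension.incl K (FiniteAdeleRing (𝓞 K) K) D a ∈ adelicLattice K D := by
  rw [← (adelicBasis K D).sum_repr z, Finset.sum_mul]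
  refine sum_mem fun i _ => ?_
  rw [smul_mul_assoc]
  refine smul_mem_adelicLattice K D (hz i) ?_
  rw [adelicBasis_apply, ← map_mul, ← mem_globalLattice_iff]
  exact ha _ (finBasis_mem_globalLattice K D i)

/-- `latticeOf x` is an `𝓞_K`-module. [folklore] -/
theorem smul_mem_latticeOf {x : finiteAdelicUnits K D} (r : 𝓞 K) {m : D}
    (hm : m ∈ latticeOf K D x) : (r : K) • m ∈ latticeOf K D x := by
  rw [mem_latticeOf_iff, incl_smul, ← IsScalarTower.algebraMap_apply, mul_smul_comm]
  exact smul_mem_adelicLattice K D (algebraMap_integers_mem_integralFiniteAdeles K r) hm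

/-- `latticeOf x` is a right `Λ`-module. [folklore] -/
theorem mul_mem_latticeOf {x : finiteAdelicUnits K D} {m : D} (hm : m ∈ latticeOf K D x) {a : D}
    (ha : a ∈ rightOrder K D) : m * a ∈ latticeOf K D x := by
  rw [mem_latticeOf_iff, map_mul, ← mul_assoc]
  exact mul_incl_mem_adelicLattice K hm ha

/-- Right `U₀`-invariance: `latticeOf (x u) = latticeOf x` for `u ∈ U₀ = Stab(L̂)`. [folklore] -/
theorem latticeOf_mul_of_mem_unitStabilizer (x : finiteAdelicUnits K D) {u : finiteAdelicUnits K D}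
    (hu : u ∈ unitStabilizer K D) : latticeOf K D (x * u) = latticeOf K D x := by
  ext d
  rw [mem_latticeOf_iff, mem_latticeOf_iff, mul_inv_rev, Units.val_mul, mul_assoc]
  obtain ⟨hu₁, hu₂⟩ := (mem_unitStabilizer_iff K D).mp hu
  constructor
  · intro h
    have := hu₁ _ h
    rwa [← mul_assoc, Units.mul_inv, one_mul] at this
  · intro h
    exact hu₂ _ h

/-- Left `Dˣ`-equivariance: `latticeOf (d x) = d · latticeOf x` for `d ∈ Dˣ`. [folklore] -/
theorem latticeOf_inclFinite_mul (d : Dˣ) (x : finiteAdelicUnits K D) :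
    latticeOf K D (inclFinite K D d * x) = d • latticeOf K D x := by
  ext m
  rw [mem_units_smul_submodule_iff, mem_latticeOf_iff, mem_latticeOf_iff, mul_inv_rev,
    Units.val_mul, mul_assoc, ← map_inv, Units.smul_def, smul_eq_mul, map_mul]
  rfl

/-- **Finiteness and fullness of `D ∩ x L̂`** (Weil, BNT Ch. V §2 Thm. 2, existence half, for the
adelic lattice `x L̂`): `latticeOf x` is a full lattice. If `c ∈ 𝓞_K ∖ 0` is a common
denominator of the `x ẽ_i` then `latticeOf x ⊆ c⁻¹ L`; and `c d ∈ latticeOf x` whenever `c`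
clears the denominators of `x⁻¹ (1 ⊗ d)`. [folklore] -/
theorem isFullLattice_latticeOf (x : finiteAdelicUnits K D) : IsFullLattice D (latticeOf K D x) := by
  constructor
  · -- `c x ∈ A` for a common denominator `c` of the coordinates of the `x ẽ_i`
    obtain ⟨c, hc, h⟩ := exists_mul_mem_integralFiniteAdeles K
      fun p : Fin (Module.finrank K D) × Fin (Module.finrank K D) =>
        (adelicBasis K D).repr ((x : ScalarExtension K (FiniteAdeleRing (𝓞 K) K) D) *
          adelicBasis K D p.1) p.2
    have hcx : algebraMap (𝓞 K) (FiniteAdeleRing (𝓞 K) K) c •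
        (x : ScalarExtension K (FiniteAdeleRing (𝓞 K) K) D) ∈ multiplier K D := by
      refine (mem_multiplier_iff K D).mpr fun i j => ?_
      rw [smul_mul_assoc, map_smul, Finsupp.smul_apply, smul_eq_mul]
      exact h (i, j)
    have hcK : (c : K) ≠ 0 := RingOfIntegers.coe_ne_zero_iff.mpr hc
    refine Submodule.FG.of_le
      ((globalLattice_fg K D).map (DistribSMul.toLinearMap ℤ D (c : K)⁻¹)) fun d hd => ?_
    refine ⟨(c : K) • d, ?_, ?_⟩
    · change (c : K) • d ∈ globalLattice K D
      rw [mem_globalLattice_iff, incl_smul, ← IsScalarTower.algebraMap_apply]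
      have := hcx _ ((mem_latticeOf_iff K).mp hd)
      rwa [smul_mul_assoc, ← mul_assoc, Units.mul_inv, one_mul] at this
    · change (c : K)⁻¹ • (c : K) • d = d
      rw [smul_smul, inv_mul_cancel₀ hcK, one_smul]
  · intro d
    obtain ⟨c, hc, h⟩ := exists_smul_mem_adelicLattice K D
      (((x⁻¹ : finiteAdelicUnits K D) : ScalarExtension K (FiniteAdeleRing (𝓞 K) K) D) *
        ScalarExtension.incl K (FiniteAdeleRing (𝓞 K) K) D d)
    refine exists_zsmul_mem_of_smul_mem K (fun r _ hm => smul_mem_latticeOf K r hm) hc ?_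
    rw [mem_latticeOf_iff, incl_smul, ← IsScalarTower.algebraMap_apply, mul_smul_comm]
    exact h

/-- **Injectivity of the dictionary** (Weil, BNT Ch. V §2 Thm. 2, uniqueness half; Vignéras
III §5): if `D` is dense in `D_f` and `D ∩ x L̂ ⊆ D ∩ y L̂`, then `x L̂ ⊆ y L̂`, i.e.
`y⁻¹ x ∈ A` — an open set is contained in the closure of its dense part. [folklore] -/
theorem inv_mul_mem_multiplier_of_latticeOf_le
    (hd : DenseRange (ScalarExtension.incl K (FiniteAdeleRing (𝓞 K) K) D))
    {x y : finiteAdelicUnits K D} (h : latticeOf K D x ≤ latticeOf K D y) :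
    ((y⁻¹ * x : finiteAdelicUnits K D) : ScalarExtension K (FiniteAdeleRing (𝓞 K) K) D) ∈
      multiplier K D := by
  intro z hz
  -- `O = x L̂` is open, `S = y L̂` is closed, and `incl D ∩ O ⊆ S`
  set O : Set (ScalarExtension K (FiniteAdeleRing (𝓞 K) K) D) :=
    {w | ((x⁻¹ : finiteAdelicUnits K D) : ScalarExtension K (FiniteAdeleRing (𝓞 K) K) D) * w ∈
      adelicLattice K D} with hO
  set S : Set (ScalarExtension K (FiniteAdeleRing (𝓞 K) K) D) :=
    {w | ((y⁻¹ : finiteAdelicUnits K D) : ScalarExtension K (FiniteAdeleRing (𝓞 K) K) D) * w ∈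
      adelicLattice K D} with hS
  have hOo : IsOpen O := (isOpen_adelicLattice K D).preimage (continuous_const_mul _)
  have hSc : IsClosed S := (isClosed_adelicLattice K D).preimage (continuous_const_mul _)
  have hOS : O ⊆ S := by
    refine (hd.open_subset_closure_inter hOo).trans ?_
    refine (closure_mono ?_).trans hSc.closure_subset
    rintro _ ⟨hw, ⟨e, rfl⟩⟩
    exact h hw
  have hzO : (x : ScalarExtension K (FiniteAdeleRing (𝓞 K) K) D) * z ∈ O := by
    change _ * _ ∈ adelicLattice K D
    rwa [← mul_assoc, Units.inv_mul, one_mul]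
  have := hOS hzO
  change _ * _ ∈ adelicLattice K D at this
  rwa [Units.val_mul, mul_assoc]

/-- If `D` is dense in `D_f` and `D ∩ x L̂ = D ∩ y L̂` then `x⁻¹ y ∈ U₀`, i.e. `x U₀ = y U₀`. [folklore] -/
theorem inv_mul_mem_unitStabilizer_of_latticeOf_eq
    (hd : DenseRange (ScalarExtension.incl K (FiniteAdeleRing (𝓞 K) K) D))
    {x y : finiteAdelicUnits K D} (h : latticeOf K D x = latticeOf K D y) :
    x⁻¹ * y ∈ unitStabilizer K D := by
  refine (mem_unitStabilizer_iff K D).mpr ⟨?_, ?_⟩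
  · exact inv_mul_mem_multiplier_of_latticeOf_le K hd h.ge
  · rw [mul_inv_rev, inv_inv]
    exact inv_mul_mem_multiplier_of_latticeOf_le K hd h.le

end GlobalLattices

/-! ### The Jordan–Zassenhaus theorem (proved in `JordanZassenhaus`) -/

section Facts

/-- **The Jordan–Zassenhaus theorem, for orders in quaternion algebras over number fields.**
Let `D` be a quaternion algebra over a number field `K` and `Λ ⊆ D` a `ℤ`-order (a full lattice
containing `1` and closed under multiplication). Then the full lattices `M ⊆ D` with `M Λ ⊆ M`
(the full right `Λ`-lattices in `D`) fall into finitely many orbits under left multiplication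
by `Dˣ`: there is a finite set `T` of them such that every such `M` is `d⁻¹ M'` for some `d ∈ Dˣ`,
`M' ∈ T`. This is the Jordan–Zassenhaus theorem (Zassenhaus 1938; Swan–Evans, *K-theory of finite
groups and orders*, LNM 149, Ch. 3: Definition before Lemma 3.7, Thm. 3.9 for `R = ℤ`, Cor. 3.10
for rings of integers, Lemma 3.11 for the change of order; Reiner, *Maximal Orders*, §26
Thm. (26.4)) specialised to `R = ℤ`, `A = D` and full right `Λ`-lattices `M ⊆ D` (an isomorphism
`M ≅ M'` of right `Λ`-modules extends to a right `D`-linear automorphism of `D = M ⊗ ℚ`, i.e. to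
left multiplication by some `d ∈ Dˣ`, so isomorphism classes are exactly `Dˣ`-orbits).
Classically (Vignéras III §5 Thm. 5.4) this is the finiteness of the number of classes of right
ideals of an order. PROVED: this is `hasFiniteClassSet_of_isQuaternionAlgebra` of
`Literature.NumberTheory.Automorphic.JordanZassenhaus`, restated in unfolded form. [cite: SwanEvans1970, Ch. 3 Thm. 3.9 with Cor. 3.10 and Lemma 3.11 (Jordan–Zassenhaus theorem for ℤ and for rings of integers)] -/
theorem jordanZassenhaus :
    ∀ (K : Type) [Field K] [NumberField K] (D : Type u) [Ring D] [Algebra K D]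
      [IsQuaternionAlgebra K D] (Λ : Submodule ℤ D), (1 : D) ∈ Λ →
      (∀ a ∈ Λ, ∀ b ∈ Λ, a * b ∈ Λ) → IsFullLattice D Λ →
      ∃ T : Finset (Submodule ℤ D), ∀ M : Submodule ℤ D, IsFullLattice D M →
        (∀ m ∈ M, ∀ a ∈ Λ, m * a ∈ M) → ∃ d : Dˣ, d • M ∈ T :=
  fun K _ _ D _ _ _ Λ h1 hmul hΛ => hasFiniteClassSet_of_isQuaternionAlgebra K D Λ h1 hmul hΛ

end Facts

/-! ### Assembly: finiteness of `Dˣ \ D_fˣ / U₀` and Borel's Thm. 5.1 for `G = Dˣ` -/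

section Assembly

variable (K : Type) [Field K] [NumberField K] (D : Type u) [Ring D] [Algebra K D]

/-- **`D` is dense in `D_f = 𝔸_K^∞ ⊗_K D`** (`K` is dense in `𝔸_K^∞`,
`denseRange_algebraMap_finiteAdeleRing`; `D_f ≃ₜ (𝔸_K^∞)^n` by coordinates, `D ≃ K^n`, and a
product of dense sets is dense); Weil, BNT Ch. IV §2 Thm. 3 Cor. 2 for `E = D`. [folklore] -/
theorem denseRange_incl [Module.Finite K D] :
    DenseRange (ScalarExtension.incl K (FiniteAdeleRing (𝓞 K) K) D) := by
  have hpi : Dense (Set.pi Set.univ fun _ : Fin (Module.finrank K D) =>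
      Set.range (algebraMap K (FiniteAdeleRing (𝓞 K) K))) :=
    dense_pi Set.univ fun _ _ => denseRange_algebraMap_finiteAdeleRing (𝓞 K) K
  have himage := (ScalarExtension.coordHomeomorph K (FiniteAdeleRing (𝓞 K) K) D).symm.surjective
    |>.denseRange.dense_image (Homeomorph.continuous _) hpi
  refine himage.mono ?_
  rintro _ ⟨c, hc, rfl⟩
  choose k hk using fun i => hc i (Set.mem_univ i)
  refine ⟨(Module.finBasis K D).equivFun.symm k, ?_⟩
  rw [eq_comm, Homeomorph.symm_apply_eq]
  funext i
  rw [ScalarExtension.coordHomeomorph_apply, coordLinearEquiv_apply, adelicBasis_repr_incl,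
    ← Module.Basis.equivFun_apply, LinearEquiv.apply_symm_apply, hk i]

/-- **Finiteness of `Dˣ \ D_fˣ / U₀`** for the stabiliser `U₀` of the standard adelic lattice:
the map `x ↦ [D ∩ x L̂]` from `D_fˣ` to `Dˣ`-orbits of full right `Λ`-lattices is constant on
double cosets `Dˣ x U₀` and separates them (Vignéras III §5, "dictionnaire global-adélique" and
Thm. 5.4; Weil, BNT Ch. V §2 Thm. 2), and there are finitely many orbits by the Jordan–Zassenhaus
theorem. This is Borel's `c(G) < ∞` (1963, Thm. 5.1) for `G = Dˣ`. [cite: BorelIHES1963, Thm. 5.1 (for G = Dˣ)] -/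
theorem finite_doubleQuotient_unitStabilizer [IsQuaternionAlgebra K D] :
    Finite (orbitRel.Quotient (inclFinite K D).range
      (finiteAdelicUnits K D ⧸ unitStabilizer K D)) := by
  classical
  obtain ⟨T, hT⟩ := jordanZassenhaus K D (rightOrder K D) (one_mem_rightOrder K D)
    (fun a ha b hb => mul_mem_rightOrder K ha hb) (isFullLattice_rightOrder K D)
  have hx : ∀ x : finiteAdelicUnits K D, ∃ d : Dˣ, d • latticeOf K D x ∈ T := fun x =>
    hT _ (isFullLattice_latticeOf K x) fun m hm a ha => mul_mem_latticeOf K hm ha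
  choose δ hδ using hx
  set Γ : Subgroup (finiteAdelicUnits K D) := (inclFinite K D).range with hΓ
  let cls : finiteAdelicUnits K D →
      orbitRel.Quotient Γ (finiteAdelicUnits K D ⧸ unitStabilizer K D) :=
    fun x => Quotient.mk'' (x : finiteAdelicUnits K D ⧸ unitStabilizer K D)
  have hcls : Function.Surjective cls := by
    intro q
    induction q using Quotient.inductionOn' with
    | h y =>
      induction y using QuotientGroup.induction_on with
      | H x => exact ⟨x, rfl⟩
  -- two points with the same normalised lattice lie in the same double coset
  have hkey : ∀ x y : finiteAdelicUnits K D,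
      δ x • latticeOf K D x = δ y • latticeOf K D y → cls x = cls y := by
    intro x y hxy
    have h1 : latticeOf K D (inclFinite K D ((δ y)⁻¹ * δ x) * x) = latticeOf K D y := by
      rw [latticeOf_inclFinite_mul, mul_smul, hxy, inv_smul_smul]
    have h2 := inv_mul_mem_unitStabilizer_of_latticeOf_eq K (denseRange_incl K D) h1
    refine Quotient.sound' (Setoid.symm' _ ?_)
    refine MulAction.mem_orbit_iff.mpr ⟨⟨inclFinite K D ((δ y)⁻¹ * δ x), _, rfl⟩, ?_⟩
    change inclFinite K D ((δ y)⁻¹ * δ x) • ((x : finiteAdelicUnits K D ⧸ unitStabilizer K D)) =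
      (y : finiteAdelicUnits K D ⧸ unitStabilizer K D)
    rw [MulAction.Quotient.smul_coe, smul_eq_mul]
    exact QuotientGroup.eq.mpr h2
  have hfin : (Set.univ :
      Set (orbitRel.Quotient Γ (finiteAdelicUnits K D ⧸ unitStabilizer K D))).Finite := by
    have hsub : (Set.univ :
        Set (orbitRel.Quotient Γ (finiteAdelicUnits K D ⧸ unitStabilizer K D))) ⊆
        ⋃ t ∈ (T : Set (Submodule ℤ D)), cls '' {x | δ x • latticeOf K D x = t} := by
      intro q _
      obtain ⟨x, rfl⟩ := hcls q
      exact Set.mem_biUnion (Finset.mem_coe.mpr (hδ x)) ⟨x, rfl, rfl⟩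
    refine Set.Finite.subset (Set.Finite.biUnion (Finset.finite_toSet T) fun t _ => ?_) hsub
    refine Set.Subsingleton.finite ?_
    rintro _ ⟨x, hx, rfl⟩ _ ⟨y, hy, rfl⟩
    exact hkey x y (hx.trans hy.symm)
  exact Set.finite_univ_iff.mp hfin

/-- **Borel's Theorem 5.1 for `G = Dˣ` (discharge of the named fact
`QuaternionicForm.exists_isCompact_isOpen_finite_doubleQuotient`).** The stabiliser `U₀` of the
standard adelic lattice is a compact open subgroup of `D_fˣ` with `Dˣ \ D_fˣ / U₀` finite
(Borel 1963, §1.2 and Thm. 5.1 for `G = Dˣ`; proved here through the lattice dictionary and the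
Jordan–Zassenhaus theorem rather than Borel's reduction theory). [cite: BorelIHES1963, §1.2 and Thm. 5.1] -/
theorem QuaternionicForm.exists_isCompact_isOpen_finite_doubleQuotient_holds :
    QuaternionicForm.exists_isCompact_isOpen_finite_doubleQuotient (K := K) (D := D) := by
  intro _
  exact ⟨unitStabilizer K D, isCompact_unitStabilizer K D, isOpen_unitStabilizer K D,
    finite_doubleQuotient_unitStabilizer K D⟩

variable {K D} in
/-- **Finiteness of `Dˣ \ D_fˣ / U` for every open `U` (discharge of the named fact
`QuaternionicForm.finite_doubleQuotient`)**: Borel's Thm. 5.1 for `G = Dˣ` at level `U₀`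
(`QuaternionicForm.exists_isCompact_isOpen_finite_doubleQuotient_holds`) and the change of level
`QuaternionicForm.finite_doubleQuotient_of_exists`. [cite: BorelIHES1963, Thm. 5.1] -/
theorem QuaternionicForm.finite_doubleQuotient_holds (U : Subgroup (finiteAdelicUnits K D)) :
    QuaternionicForm.finite_doubleQuotient U :=
  QuaternionicForm.finite_doubleQuotient_of_exists U
    (QuaternionicForm.exists_isCompact_isOpen_finite_doubleQuotient_holds K D)

end Assembly

end Literature.NumberTheory.Automorphic
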